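import Summits.QuantumAdvantage.QuantumAdvantage.Theorems.CubicForrelationNearExactIsExactRothausB

/-!
# Crux `CubicForrelation.NearExactIsExact` (stmt-QuantumAdvantage-14043), line `direct-sum-amplification` —
stub LCap: the capacity cost of a 2-adic level below the bent level (`stub_levelCapacity`)

In the tree's `Bool` / `IsDegLeFun` / `W` vocabulary (`W_g(x) = Σ_y (−1)^{g(y)} (−1)^{y·x}`, the unnormalised Walsh
transform of `(−1)^g`). On `m + m` bits: if `W_g(x) = 2^j · u(x)` with `u(x) ∈ ℤ` for every `x`, where `j < m`, and
the parity function `x ↦ [u(x) odd]` has algebraic degree `≤ d` and is not identically zero, then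
`Σ_x |W_g(x)| ≤ 2^{3m} · (1 − (1/2)^{d+1} (1/4)^{m−j})`. No hypothesis on the degree of `g` is needed.

Proof. Put `K = 2^{m−j}`, an EVEN integer (`j < m`). Pointwise, `(|u(x)| − K)² ≥ [u(x) odd]`: if `u(x)` is odd then
`|u(x)| − K` is odd, hence non-zero, so its square is `≥ 1` (`lc_pointwise`); i.e.
`2K |u(x)| ≤ u(x)² + K² − [u(x) odd]`. Summing over the `2^{m+m}` points: `Σ_x u(x)² = 2^{4m−2j}` by Parseval
(`sum_W_sq`: `Σ_x W_g(x)² = 2^{m+m} · 2^{m+m}`), `2^{m+m} K² = 2^{4m−2j}` as well, and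
`#{x : u(x) odd} ≥ 2^{m+m−d}` by the Reed–Muller minimum weight of the (non-zero, degree `≤ d`) parity function
(`bb_rmWeight_holds`). Finally `Σ_x |W_g(x)| = 2^j Σ_x |u(x)|`, and the arithmetic
`2^j (2 · 2^{4m−2j} − 2^{m+m−d}) / (2K) = 2^{3m} (1 − (1/2)^{d+1} (1/4)^{m−j})` closes the bound.

Sources: O. S. Rothaus, *On "bent" functions*, JCTA 20 (1976) (the 2-adic normalisation of Walsh spectra);
F. J. MacWilliams, N. J. A. Sloane, *The Theory of Error-Correcting Codes*, Ch. 13 §3 (RM minimum weight, here the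
landed `bb_rmWeight_holds`); R. O'Donnell, *Analysis of Boolean Functions* (CUP 2014), §1.4 (Parseval, here the landed
`sum_W_sq`). Everything below is proved from Mathlib and the tree; axioms are the standard three.
-/

set_option linter.dupNamespace false -- D-0017: single-problem summit ⇒ `QuantumAdvantage.QuantumAdvantage` by design

noncomputable section

namespace Summit.QuantumAdvantage.QuantumAdvantage.Theorems.CubicForrelation.NearExactIsExact

open Finset
open Literature.Computability.QuantumComplexity
open Literature.Computability.QuantumComplexity.DerivativeWalsh (W sum_W_sq)
open Literature.Computability.QuantumComplexity.BuzetChailloux (signOf_sq)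

/-- The pointwise key inequality: for an integer `u` and an EVEN natural number `K`,
`2K|u| ≤ u² + K² − [u odd]`. If `u` is odd then `|u| − K` is odd, hence non-zero, so `(|u| − K)² ≥ 1`; otherwise
`(|u| − K)² ≥ 0`. [folklore] -/
theorem lc_pointwise (u : ℤ) (K : ℕ) (hK : Even K) :
    2 * (K : ℝ) * |(u : ℝ)| ≤ (u : ℝ) ^ 2 + (K : ℝ) ^ 2 - (if Odd u then 1 else 0) := by
  split_ifs with hu
  · have hodd : Odd (|u| - (K : ℤ)) := (odd_abs.2 hu).sub_even ((Int.even_coe_nat K).2 hK)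
    have hne : |u| - (K : ℤ) ≠ 0 := by
      rintro h
      rw [h] at hodd
      exact (Int.not_odd_iff_even.2 (by decide)) hodd
    have h1 : (1 : ℤ) ≤ (|u| - K) ^ 2 := (one_le_sq_iff_one_le_abs _).2 (Int.one_le_abs hne)
    have h2 : (2 : ℤ) * K * |u| ≤ u ^ 2 + (K : ℤ) ^ 2 - 1 := by nlinarith [sq_abs u, h1]
    have h3 : ((2 * K * |u| : ℤ) : ℝ) ≤ ((u ^ 2 + (K : ℤ) ^ 2 - 1 : ℤ) : ℝ) := by exact_mod_cast h2
    push_cast at h3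
    exact h3
  · nlinarith [sq_nonneg (|(u : ℝ)| - K), sq_abs (u : ℝ)]

/-- **LCap — the capacity cost of a non-vanishing 2-adic level below the bent level** (no degree hypothesis on `g`).
On `m + m` bits: if `W_g(x) = 2^j · u(x)` (`u(x) ∈ ℤ`) for every `x` with `j < m`, and the parity `x ↦ [u(x) odd]`
has degree `≤ d` and is not identically zero, then `Σ_x |W_g(x)| ≤ 2^{3m} · (1 − (1/2)^{d+1} (1/4)^{m−j})`.
Proof: with `K = 2^{m−j}` even, pointwise `2K|u(x)| ≤ u(x)² + K² − [u(x) odd]` (`lc_pointwise`); summing,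
`Σ_x u(x)² = 2^{4m−2j}` (Parseval, `sum_W_sq`) and `#{x : u(x) odd} ≥ 2^{m+m−d}` (`bb_rmWeight_holds`);
`Σ|W| = 2^j Σ|u|`. -/
theorem stub_levelCapacity :
    ∀ (m j d : ℕ) (g : (Fin (m + m) → Bool) → Bool) (u : (Fin (m + m) → Bool) → ℤ), j < m →
      (∀ x, W (fun y => signOf (g y)) x = (2 : ℝ) ^ j * (u x : ℝ)) →
      IsDegLeFun d (fun x => decide (Odd (u x))) → (∃ x, Odd (u x)) →
      ∑ x, |W (fun y => signOf (g y)) x| ≤ (2 : ℝ) ^ (3 * m) * (1 - (1 / 2) ^ (d + 1) * (1 / 4) ^ (m - j)) := by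
  intro m j d g u hj hu hdeg hne
  obtain ⟨t, rfl⟩ : ∃ t, m = j + 1 + t := ⟨m - j - 1, by omega⟩
  -- (e) `Σ|W| = 2^j Σ|u|`
  have hsumW : ∑ x, |W (fun y => signOf (g y)) x| = (2 : ℝ) ^ j * ∑ x, |(u x : ℝ)| := by
    rw [mul_sum]
    refine sum_congr rfl fun x _ => ?_
    rw [hu x, abs_mul, abs_of_pos (by positivity)]
  -- the number of points
  have hcard : (univ : Finset (Fin (j + 1 + t + (j + 1 + t)) → Bool)).card = 2 ^ (j + 1 + t + (j + 1 + t)) := by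
    rw [card_univ, Fintype.card_fun, Fintype.card_bool, Fintype.card_fin]
  -- (a) Parseval: `2^{2j} Σ u² = 2^{m+m} · 2^{m+m}`
  have hpars : ((2 : ℝ) ^ j) ^ 2 * ∑ x, (u x : ℝ) ^ 2 =
      (2 : ℝ) ^ (j + 1 + t + (j + 1 + t)) * (2 : ℝ) ^ (j + 1 + t + (j + 1 + t)) := by
    have h1 := sum_W_sq (fun y => signOf (g y))
    simp only [signOf_sq, sum_const, hcard, nsmul_eq_mul, mul_one, Nat.cast_pow, Nat.cast_ofNat] at h1
    rw [← h1, mul_sum]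
    exact sum_congr rfl fun x _ => by rw [hu x, mul_pow]
  -- (b)+(c) the pointwise inequality, summed: `2K Σ|u| ≤ Σ u² + 2^{m+m} K² − #{u odd}`, `K = 2^{t+1} = 2^{m−j}`
  have hpt : 2 * (2 : ℝ) ^ (t + 1) * ∑ x, |(u x : ℝ)| ≤
      ∑ x, (u x : ℝ) ^ 2 + (2 : ℝ) ^ (j + 1 + t + (j + 1 + t)) * ((2 : ℝ) ^ (t + 1)) ^ 2 -
        ((univ.filter fun x => Odd (u x)).card : ℝ) := by
    have hK : Even (2 ^ (t + 1)) := Nat.even_pow.2 ⟨even_two, Nat.succ_ne_zero t⟩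
    have key : ∀ x ∈ (univ : Finset (Fin (j + 1 + t + (j + 1 + t)) → Bool)),
        2 * (2 : ℝ) ^ (t + 1) * |(u x : ℝ)| ≤
          (u x : ℝ) ^ 2 + ((2 : ℝ) ^ (t + 1)) ^ 2 - (if Odd (u x) then 1 else 0) := by
      intro x _
      have h := lc_pointwise (u x) (2 ^ (t + 1)) hK
      push_cast at h
      exact h
    have hconst : ∑ _x : Fin (j + 1 + t + (j + 1 + t)) → Bool, ((2 : ℝ) ^ (t + 1)) ^ 2 =
        (2 : ℝ) ^ (j + 1 + t + (j + 1 + t)) * ((2 : ℝ) ^ (t + 1)) ^ 2 := by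
      rw [sum_const, hcard, nsmul_eq_mul]
      push_cast
      ring
    have hboole : ∑ x : Fin (j + 1 + t + (j + 1 + t)) → Bool, (if Odd (u x) then (1 : ℝ) else 0) =
        ((univ.filter fun x => Odd (u x)).card : ℝ) :=
      sum_boole _ _
    calc 2 * (2 : ℝ) ^ (t + 1) * ∑ x, |(u x : ℝ)| = ∑ x, 2 * (2 : ℝ) ^ (t + 1) * |(u x : ℝ)| := by rw [mul_sum]
      _ ≤ ∑ x, ((u x : ℝ) ^ 2 + ((2 : ℝ) ^ (t + 1)) ^ 2 - (if Odd (u x) then 1 else 0)) := sum_le_sum key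
      _ = _ := by rw [sum_sub_distrib, sum_add_distrib, hconst, hboole]
  -- (d) the Reed–Muller weight of the parity function: `2^{m+m} ≤ 2^d · #{u odd}`
  have hrm : (2 : ℝ) ^ (j + 1 + t + (j + 1 + t)) ≤ (2 : ℝ) ^ d * ((univ.filter fun x => Odd (u x)).card : ℝ) := by
    obtain ⟨x₀, hx₀⟩ := hne
    have h1 := bb_rmWeight_holds (j + 1 + t + (j + 1 + t)) d (fun x => decide (Odd (u x))) hdeg
      ⟨x₀, decide_eq_true hx₀⟩
    simp only [decide_eq_true_eq] at h1
    exact_mod_cast h1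
  -- exponent bookkeeping: `P = 2^j`, `Q = 2^{t+1} = 2^{m−j}`, `R = 2^{d+1}`
  have e1 : (2 : ℝ) ^ (j + 1 + t + (j + 1 + t)) = ((2 : ℝ) ^ j) ^ 2 * ((2 : ℝ) ^ (t + 1)) ^ 2 := by
    rw [show j + 1 + t + (j + 1 + t) = (j + (t + 1)) * 2 by ring, pow_mul, pow_add, mul_pow]
  have e3 : (2 : ℝ) ^ (3 * (j + 1 + t)) = ((2 : ℝ) ^ j) ^ 3 * ((2 : ℝ) ^ (t + 1)) ^ 3 := by
    rw [show 3 * (j + 1 + t) = (j + (t + 1)) * 3 by ring, pow_mul, pow_add, mul_pow]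
  have e4' : ((2 : ℝ) ^ (t + 1)) ^ 2 = (4 : ℝ) ^ (t + 1) := by
    rw [← pow_mul, mul_comm, pow_mul]
    norm_num
  have e4 : (1 / 4 : ℝ) ^ (j + 1 + t - j) = 1 / ((2 : ℝ) ^ (t + 1)) ^ 2 := by
    rw [show j + 1 + t - j = t + 1 by omega, one_div_pow, e4']
  rw [hsumW, e3, e4, one_div_pow]
  rw [e1] at hpars hpt hrm
  have hP0 : (0 : ℝ) < (2 : ℝ) ^ j := by positivity
  have hQ0 : (0 : ℝ) < (2 : ℝ) ^ (t + 1) := by positivity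
  have hR0 : (0 : ℝ) < (2 : ℝ) ^ (d + 1) := by positivity
  have hrm2 : 2 * (((2 : ℝ) ^ j) ^ 2 * ((2 : ℝ) ^ (t + 1)) ^ 2) ≤
      (2 : ℝ) ^ (d + 1) * ((univ.filter fun x => Odd (u x)).card : ℝ) := by
    rw [pow_succ (2 : ℝ) d]
    linarith [hrm]
  set P : ℝ := (2 : ℝ) ^ j
  set Q : ℝ := (2 : ℝ) ^ (t + 1)
  set R : ℝ := (2 : ℝ) ^ (d + 1)
  -- (a) solved for `Σ u²`
  have hS2 : ∑ x, (u x : ℝ) ^ 2 = P ^ 2 * Q ^ 4 := by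
    apply mul_left_cancel₀ (pow_ne_zero 2 hP0.ne')
    rw [hpars]
    ring
  rw [hS2] at hpt
  -- (e) assemble
  have h2 : R * (P * (2 * Q * ∑ x, |(u x : ℝ)|)) ≤
      R * (P * (P ^ 2 * Q ^ 4 + P ^ 2 * Q ^ 2 * Q ^ 2 - ((univ.filter fun x => Odd (u x)).card : ℝ))) :=
    mul_le_mul_of_nonneg_left (mul_le_mul_of_nonneg_left hpt hP0.le) hR0.le
  have h3 : P * (2 * (P ^ 2 * Q ^ 2)) ≤ P * (R * ((univ.filter fun x => Odd (u x)).card : ℝ)) :=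
    mul_le_mul_of_nonneg_left hrm2 hP0.le
  have key : P * (∑ x, |(u x : ℝ)|) * (Q * R) ≤ P ^ 3 * Q ^ 4 * R - P ^ 3 * Q ^ 2 := by
    linarith [h2, h3]
  have hgoal : P ^ 3 * Q ^ 3 * (1 - 1 / R * (1 / Q ^ 2)) = (P ^ 3 * Q ^ 4 * R - P ^ 3 * Q ^ 2) / (Q * R) := by
    field_simp
  rw [hgoal, le_div_iff₀ (mul_pos hQ0 hR0)]
  exact key

end Summit.QuantumAdvantage.QuantumAdvantage.Theorems.CubicForrelation.NearExactIsExact
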